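import Summits.NavierStokesRegularity.FluidComputer.HeadStartDelay
import Summits.NavierStokesRegularity.FluidComputer.HeadStartPulse

/-!
# The signed head-start gate, part 9 (bp1 gen 20, BLOCK 4): the gate theorem for a CLOCK BEHIND with the sharp
# critical time, under the POLYNOMIAL-TYPE amplitude threshold

Companion of `HeadStart{Transition,Quiet,Sub,Window,Fire,Douse,Beable,Delay}.lean` (parts 1–8) and of the pulse
chain `HeadStartPulse{Fire,Douse,Beable,}.lean` (cell `pub-fluidc`, seat bp1).
HONEST FRAMING (verbatim): low prior, high value-of-information experiment on Tao's machine paradigm; NOT a claim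
that NS blows up. Five-mode truncation (5.5) of [Tao2016AveragedNS, §5.5]; nothing is proved about Navier–Stokes.

Part 8 (`HeadStart.firingPhase_delay`) locates the critical time of a clock BEHIND (`-ε/5 ≤ b₀ ≤ 0`) sharply,
`|t_c - (√2 - b₀/ε)| ≤ 12 log K/M + 15η`, under the exponential amplitude threshold `ε ≤ e^{-10M}/K¹⁰⁰` of part 7.
As in `HeadStartPulse.lean`, that smallness is used in ONE place only (the clock surviving on all of `[t_c, 2]`);
replacing the late phase by the pulse chain's `HeadStart.sum_sq_from` (pulse hypothesis up to the delivery time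
`t_c + 888 log K/M + 1/K + 300 log K/K`, then `a² + b² + c² + d²` non-increasing under damping) gives the SAME
statement under `ε ≤ e^{-900·M·log K/K}/K²³⁰⁰`:
* `HeadStart.firingPhase_delay_poly` — part 8's `HeadStart.firingPhase_delay` VERBATIM except `hεle`;
* `HeadStart.firingPhase_delay_polyLinear` — `900·M·log K ≤ K` and `ε ≤ K⁻²³⁰¹`;
* `HeadStart.firingPhase_delay_poly_explicit` — the explicit datum `(√(1 - b₀²), b₀, 0, 0, 0)`, `-ε/5 ≤ b₀ ≤ 0`.
The sharp-time lemma `tc_delay` and the quiet phase are part 8's / part 4's, reused BY NAME.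
[cite: Tao2016AveragedNS, Theorem 5.3, §5.5]. No named facts; 0 sorry.
-/

noncomputable section

namespace Summit.NavierStokesRegularity.FluidComputer

open Real Set Filter Topology
open Literature.Analysis.FluidPDE.Tao2016AveragedNS
open Literature.Analysis.FluidPDE.Tao2016AveragedNS.Thm53 (invSqrt_facts)
open Literature.Analysis.FluidPDE.Tao2016AveragedNS.Thm53With (family_params)
open DampedTransition (family_params_damped)

open HeadStart in
/-- **THE GATE THEOREM FOR A CLOCK BEHIND, SHARP CRITICAL TIME, POLYNOMIAL-TYPE AMPLITUDE THRESHOLD.** The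
statement of `HeadStart.firingPhase_delay` (part 8) VERBATIM except `hεle`: family `K ≥ 2·20⁴²·42! + 16`,
`3000 log K ≤ M ≤ K¹⁰`, `0 < ε ≤ e^{-900·M·log K/K}/K²³⁰⁰`; any diagonal damping `0 ≤ Eᵢ(t) ≤ η ≤ 1/1000` on
`[0,2]`; any datum with `a₀² + b₀² = 1`, `a₀ ≥ 0`, `-ε/5 ≤ b₀ ≤ 2ε/5`, `c₀ = d₀ = ã₀ = 0`, and `b₀ ≤ 0`: a
critical time with `|t_c - (√2 - b₀/ε)| ≤ 12 log K/M + 15η`, the (able) box on `[0, t_c]` and the (beable) box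
on `[t_c + 888 log K/M + 1/√K, 2]`. HONEST FRAMING: a theorem about a five-mode ODE; low prior, high
value-of-information experiment on Tao's machine paradigm; NOT a claim that NS blows up.
[cite: Tao2016AveragedNS, Theorem 5.3, §5.5] -/
theorem HeadStart.firingPhase_delay_poly {K M ε η : ℝ} {E X : ℝ → Fin 5 → ℝ}
    (hX : ∀ t ∈ Icc (0:ℝ) 2, HasDerivAt X (delayCircuitWith K M ε (X t) - E t * X t) t)
    (hE : ∀ t ∈ Icc (0:ℝ) 2, ∀ i, 0 ≤ E t i ∧ E t i ≤ η)
    (h0 : X 0 0 ^ 2 + X 0 1 ^ 2 = 1 ∧ 0 ≤ X 0 0 ∧ -(1 / 5 * ε) ≤ X 0 1 ∧ X 0 1 ≤ 2 / 5 * ε ∧ X 0 2 = 0 ∧ X 0 3 = 0 ∧ X 0 4 = 0)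
    (hb0 : X 0 1 ≤ 0)
    (hK : 2 * 20 ^ 42 * (Nat.factorial 42 : ℝ) + 16 ≤ K) (hML : 3000 * Real.log K ≤ M)
    (hMK : M ≤ K ^ 10) (hε : 0 < ε) (hεle : ε ≤ exp (-(900 * M * Real.log K / K)) / K ^ 2300)
    (hη : η ≤ 1 / 1000) :
    ∃ tc : ℝ, |tc - (Real.sqrt 2 - X 0 1 / ε)| ≤ 12 * Real.log K / M + 15 * η ∧
      (∀ t ∈ Icc 0 tc,
        |X t 0 - 1| ≤ 200 / K ^ 10 + 2 * η ∧ ∀ i : Fin 5, i ≠ 0 → |X t i| ≤ 200 / K ^ 10) ∧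
      (∀ t ∈ Icc (tc + 888 * Real.log K / M + 1 / Real.sqrt K) 2,
        |X t 4 - 1| ≤ 200 / K ^ 10 + 4 * η ∧ ∀ i : Fin 5, i ≠ 4 → |X t i| ≤ 200 / K ^ 10) := by
  obtain ⟨hK16, hM0, -, hlog2, -, -⟩ := family_params hK hML
  have hf : (1:ℝ) ≤ (Nat.factorial 42 : ℝ) := Nat.one_le_cast.2 (Nat.factorial_pos 42)
  have hK400 : (400:ℝ) ≤ K := by linarith
  obtain ⟨hδ0, hon, hδle⟩ := family_params_damped hK hML
  have hK0 : 0 < K := by linarith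
  have hu0' : 0 < K⁻¹ := inv_pos.2 hK0
  have hη100 : η ≤ 1 / 100 := hη.trans (by norm_num)
  have hML1250 : 1250 * Real.log K ≤ M := by linarith
  have hlog0 : 0 ≤ Real.log K := by linarith
  have hL0 : 0 ≤ 300 * Real.log K / K := by positivity
  have hd0 : 0 ≤ 888 * Real.log K / M := by positivity
  have hKM : exp (-M) ≤ 1 / K ^ 10 := exp_neg_le_inv_pow hK0 (by linarith)
  obtain ⟨hε1, hεK, hε100, hεT⟩ := pulse_eps_facts hK16 hM0 hMK hε hεle
  obtain ⟨τ, ⟨hlo, -, hτ1, hτ33⟩, hcτeq, hwin⟩ :=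
    quietPhase hX hE h0 hε hε1 hM0 hMK hK16 hML1250 hεK hη
  have hcτ : ∀ t, 0 ≤ t → t ≤ τ → X t 2 ≤ ε ^ 2 / K ^ 10 :=
    fun t h0t htτ => (hwin t ⟨h0t, htτ⟩).1.2
  have hKL : K⁻¹ + 300 * Real.log K / K ≤ (sqrt K)⁻¹ := inv_add_log_le_invSqrt (K0_ge hK)
  have hfit2 : τ + 888 * Real.log K / M + K⁻¹ + 300 * Real.log K / K ≤ 2 := by
    have h1 : τ + 888 * Real.log K / M + (sqrt K)⁻¹ ≤ 2 := window_fits hK400 hτ33 hδle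
    linarith
  have hτ2 : τ ≤ 2 := by linarith
  have hεT' : 64 * M * ε ^ 2 * exp (5 * M * ((τ + 888 * Real.log K / M + K⁻¹ + 300 * Real.log K / K) - τ))
      ≤ K ^ 20 := by
    have : (τ + 888 * Real.log K / M + K⁻¹ + 300 * Real.log K / K) - τ
        = 888 * Real.log K / M + K⁻¹ + 300 * Real.log K / K := by ring
    rw [this]; exact hεT
  refine ⟨τ, tc_delay hX hE h0 hε hε1 hM0 hMK hK16 hML1250 hεK hη hb0 hτ1 hτ2 hcτ hcτeq hlo, ?_, ?_⟩
  · exact fun t ht => able_window hX hE h0 hε hε1 hM0.le hK16 hεK hε100 hτ2 hcτ ht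
  · intro t ht
    have ht' : t ∈ Icc (τ + 888 * Real.log K / M + K⁻¹ + 300 * Real.log K / K) 2 := by
      refine ⟨?_, ht.2⟩
      have h1 := ht.1
      rw [one_div] at h1
      linarith
    have ht0 : t ∈ Icc (0:ℝ) 2 := ⟨by linarith [ht'.1], ht.2⟩
    exact beable_of_sum_sq hX hE h0 hK16 ht0
      (sum_sq_from (T := τ + 888 * Real.log K / M + K⁻¹ + 300 * Real.log K / K) hX hE h0 hε hε1 hM0
        hMK hK16 hεK hε100 hKM hη100 hδ0 hon hL0 (drain_numeric hK16) hτ1 le_rfl hfit2 hεT' hcτ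
        hcτeq ht')

open HeadStart in
/-- **Linear-band corollary**: if moreover `900·M·log K ≤ K`, the plainly polynomial `ε ≤ K⁻²³⁰¹` suffices in
`HeadStart.firingPhase_delay_poly`. [cite: Tao2016AveragedNS, Theorem 5.3, §5.5] -/
theorem HeadStart.firingPhase_delay_polyLinear {K M ε η : ℝ} {E X : ℝ → Fin 5 → ℝ}
    (hX : ∀ t ∈ Icc (0:ℝ) 2, HasDerivAt X (delayCircuitWith K M ε (X t) - E t * X t) t)
    (hE : ∀ t ∈ Icc (0:ℝ) 2, ∀ i, 0 ≤ E t i ∧ E t i ≤ η)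
    (h0 : X 0 0 ^ 2 + X 0 1 ^ 2 = 1 ∧ 0 ≤ X 0 0 ∧ -(1 / 5 * ε) ≤ X 0 1 ∧ X 0 1 ≤ 2 / 5 * ε ∧ X 0 2 = 0 ∧ X 0 3 = 0 ∧ X 0 4 = 0)
    (hb0 : X 0 1 ≤ 0)
    (hK : 2 * 20 ^ 42 * (Nat.factorial 42 : ℝ) + 16 ≤ K) (hML : 3000 * Real.log K ≤ M)
    (hMK : M ≤ K ^ 10) (hMlin : 900 * M * Real.log K ≤ K) (hε : 0 < ε) (hεle : ε ≤ 1 / K ^ 2301)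
    (hη : η ≤ 1 / 1000) :
    ∃ tc : ℝ, |tc - (Real.sqrt 2 - X 0 1 / ε)| ≤ 12 * Real.log K / M + 15 * η ∧
      (∀ t ∈ Icc 0 tc,
        |X t 0 - 1| ≤ 200 / K ^ 10 + 2 * η ∧ ∀ i : Fin 5, i ≠ 0 → |X t i| ≤ 200 / K ^ 10) ∧
      (∀ t ∈ Icc (tc + 888 * Real.log K / M + 1 / Real.sqrt K) 2,
        |X t 4 - 1| ≤ 200 / K ^ 10 + 4 * η ∧ ∀ i : Fin 5, i ≠ 4 → |X t i| ≤ 200 / K ^ 10) := by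
  obtain ⟨hK16, hM0, -⟩ := family_params hK hML
  have hK0 : 0 < K := by linarith
  have hdiv : 900 * M * Real.log K / K ≤ 1 := by rw [div_le_iff₀ hK0]; linarith
  have he1 : K⁻¹ ≤ exp (-(900 * M * Real.log K / K)) := by
    have h3 : exp (1:ℝ) ≤ K := by
      have := Real.exp_one_lt_d9; linarith
    calc K⁻¹ ≤ (exp 1)⁻¹ := by
          rw [inv_le_inv₀ hK0 (exp_pos 1)]; exact h3
      _ = exp (-1) := by rw [Real.exp_neg]
      _ ≤ exp (-(900 * M * Real.log K / K)) := by rw [exp_le_exp]; linarith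
  have hεle' : ε ≤ exp (-(900 * M * Real.log K / K)) / K ^ 2300 := by
    refine hεle.trans ?_
    rw [show (1 : ℝ) / K ^ 2301 = K⁻¹ / K ^ 2300 by
      rw [pow_succ, one_div, mul_inv, div_eq_mul_inv, mul_comm]]
    exact div_le_div_of_nonneg_right he1 (by positivity)
  exact HeadStart.firingPhase_delay_poly hX hE h0 hb0 hK hML hMK hε hεle' hη

open HeadStart in
/-- The gate theorem for a clock behind under the polynomial-type threshold, EXPLICIT datum
`(√(1 - b₀²), b₀, 0, 0, 0)`, `-ε/5 ≤ b₀ ≤ 0`: `|t_c - (√2 - b₀/ε)| ≤ 12 log K/M + 15η`, then (able)/(beable) as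
in `HeadStart.firingPhase_poly`. [cite: Tao2016AveragedNS, §5.5] -/
theorem HeadStart.firingPhase_delay_poly_explicit {K M ε η b₀ : ℝ} {E X : ℝ → Fin 5 → ℝ}
    (hX : ∀ t ∈ Icc (0:ℝ) 2, HasDerivAt X (delayCircuitWith K M ε (X t) - E t * X t) t)
    (hE : ∀ t ∈ Icc (0:ℝ) 2, ∀ i, 0 ≤ E t i ∧ E t i ≤ η)
    (hb0 : -(1 / 5 * ε) ≤ b₀) (hb : b₀ ≤ 0) (h0 : X 0 = ![sqrt (1 - b₀ ^ 2), b₀, 0, 0, 0])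
    (hK : 2 * 20 ^ 42 * (Nat.factorial 42 : ℝ) + 16 ≤ K) (hML : 3000 * Real.log K ≤ M)
    (hMK : M ≤ K ^ 10) (hε : 0 < ε) (hεle : ε ≤ exp (-(900 * M * Real.log K / K)) / K ^ 2300)
    (hη : η ≤ 1 / 1000) :
    ∃ tc : ℝ, |tc - (Real.sqrt 2 - b₀ / ε)| ≤ 12 * Real.log K / M + 15 * η ∧
      (∀ t ∈ Icc 0 tc,
        |X t 0 - 1| ≤ 200 / K ^ 10 + 2 * η ∧ ∀ i : Fin 5, i ≠ 0 → |X t i| ≤ 200 / K ^ 10) ∧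
      (∀ t ∈ Icc (tc + 888 * Real.log K / M + 1 / Real.sqrt K) 2,
        |X t 4 - 1| ≤ 200 / K ^ 10 + 4 * η ∧ ∀ i : Fin 5, i ≠ 4 → |X t i| ≤ 200 / K ^ 10) := by
  obtain ⟨hK16, hM0, -⟩ := family_params hK hML
  have hε1 : ε ≤ 1 := (pulse_eps_facts hK16 hM0 hMK hε hεle).1
  have hb1 : X 0 1 = b₀ := by rw [h0]; rfl
  have h := HeadStart.firingPhase_delay_poly hX hE (hs_of_explicit hε1 hb0 (hb.trans (by positivity)) h0)
    (by rw [hb1]; exact hb) hK hML hMK hε hεle hη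
  rwa [hb1] at h

end Summit.NavierStokesRegularity.FluidComputer
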